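import Summits.BirchSwinnertonDyer.BirchSwinnertonDyer.Theorems.SignedLowerHalvesSmallImageLowerHalfBothSignsRttCharRoadE1TorsionLift
import HarnessLib

/-!
# Route `SignedLowerHalves`, crux L `SmallImageLowerHalfBothSigns` (stmt-BirchSwinnertonDyer-23599), line `rtt_w3` v10 — brick D3-b of COUNT_π
# (memo `Lines/rtt_w3-BRIEF-E1b-g6.md` §9.3/§9.6 step 1→2, route D): the COEFFICIENT ENTRY of the comparison — `S`-valued cocycles of `M`
# (`S = M[π]`, brick D5-θ) pushed into a second discrete module `A` (`A = W[p] ⊗ k_S`) along an additive equivariant `ι : S → A`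
# (`M[π] = k_S(θ̄) ≅ L_θ ⊆ A`, bricks E1-a (ii′) / J-CURVE): the push-forward class is WELL DEFINED on cohomology classes as soon as
# `S`-valued coboundaries of `M` are coboundaries of `S` (for `S = M[r]`: `H⁰(H, M)` has no `r`-torsion… here simply `H⁰(H, M) = 0`), and it is
# INJECTIVE on classes as soon as `ι(S)` has an equivariant retraction `ρ : A → M` (`ρ = ι⁻¹ ∘ e₁`, the `θ`-eigenprojector of brick D2).

Width seat `bsd-line-slh-p3-w3` g16 under LEAD `cruxlead-stmt-BirchSwinnertonDyer-23599` g6 (cell `bsd-ssimc`; `--supports stmt-BirchSwinnertonDyer-23599 --as helper`).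
THEOREMS ONLY (no definition, no named fact, no instance, no `sorry`); generic continuous group cohomology in the cocycle currency of brick D5-θ
(`…RttCharRoadE1TorsionLift`, p763763: `torsion_subset_image_oneCocycleClass`). BSD / crux L / COUNT are NOT proved here.

SETTING. `H ≤ G` a subgroup of a topological group, `M`, `A` discrete `G`-modules, `S ≤ M` an additive subgroup stable under `H`,
`ι : S →+ A` additive and `H`-equivariant.
* `exists_cocycle_comp` — an `S`-valued continuous cocycle `φ ∈ Z¹(H, M)` pushes to `ψ = ι ∘ φ ∈ Z¹(H, A)`.
* ★ `oneCocycleClass_comp_eq_of_eq` — WELL-DEFINEDNESS: `[φ] = [φ']` in `H¹(H, M)` ⇒ `[ι∘φ] = [ι∘φ']` in `H¹(H, A)`, given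
  `hS0 : ∀ m, (∀ x, x•m − m ∈ S) → ∃ s ∈ S, ∀ x, x•m − m = x•s − s`; `smul_sub_mem_torsion_imp` supplies `hS0` for `S = M[r]` from `H⁰(H, M) = 0`.
* ★ `oneCocycleClass_eq_of_comp_eq` — INJECTIVITY: `[ι∘φ] = [ι∘φ']` ⇒ `[φ] = [φ']`, given an `H`-equivariant `ρ : A →+ M` with `ρ ∘ ι = incl`.
* ★★ `exists_injective_classMap` — packaged: on any set `T` of classes of `H¹(H, M)` represented by `S`-valued cocycles (D5-θ: `T = Sel[π]`) there is
  an INJECTIVE map `Ψ : T → H¹(H, A)` with `Ψ [φ] = [ι ∘ φ]`; so `#T ≤ #(Ψ '' T)` and the local conditions are read on `ι ∘ φ` (bricks D3-a/c).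

References: [SerreGaloisCohomology1997] I §2.2, §5.1 (cocycles, coboundaries, functoriality); [GreenbergVatsal2000] §2 p. 19; [Rubin1991] §4.
-/

set_option autoImplicit false
set_option linter.dupNamespace false -- D-0017: single-problem summit, the namespace repeats the problem name by design
noncomputable section

open scoped Classical

universe u

namespace Summit.BirchSwinnertonDyer.BirchSwinnertonDyer.Theorems.SmallImageCharSignedSelmer

open Literature.NumberTheory.EllipticCurves Literature.NumberTheory.GaloisRepresentations

section Entry

variable {G : Type u} [Group G] [TopologicalSpace G] [IsTopologicalGroup G] {H : Subgroup G}
  {M : Type u} [AddCommGroup M] [DistribMulAction G M] [TopologicalSpace M] [DiscreteTopology M]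
  {A : Type u} [AddCommGroup A] [DistribMulAction G A] [TopologicalSpace A] [DiscreteTopology A]
  (S : AddSubgroup M) (hS : ∀ (x : H) (m : M), m ∈ S → (x : G) • m ∈ S)
  (ι : S →+ A) (hι : ∀ (x : H) (m : S), ι ⟨(x : G) • (m : M), hS x m m.2⟩ = (x : G) • ι m)

omit [IsTopologicalGroup G] in
include hι in
/-- **Pushing an `S`-valued cocycle along `ι`.** For `φ ∈ Z¹(H, M)` with values in `S`, `x ↦ ι(φ x)` is a continuous cocycle of `A`
(`ι(φ(xy)) = ι(φ x) + ι(x•φ y) = ι(φ x) + x•ι(φ y)`; continuity: `M`, `A` discrete). [cite: SerreGaloisCohomology1997, I §2.2] -/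
theorem exists_cocycle_comp (φ : contOneCocycles (discreteTopRep H M)) (hφ : ∀ x : H, φ.1 x ∈ S) :
    ∃ ψ : contOneCocycles (discreteTopRep H A), ∀ x : H, ψ.1 x = ι ⟨φ.1 x, hφ x⟩ := by
  have hcont : Continuous fun x : H ↦ ι ⟨φ.1 x, hφ x⟩ :=
    (continuous_of_discreteTopology (f := fun s : S ↦ ι s)).comp (φ.1.continuous.subtype_mk _)
  refine ⟨⟨⟨fun x ↦ ι ⟨φ.1 x, hφ x⟩, hcont⟩, fun x y ↦ ?_⟩, fun x ↦ rfl⟩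
  change ι ⟨φ.1 (x * y), hφ (x * y)⟩ = ι ⟨φ.1 x, hφ x⟩ + x • ι ⟨φ.1 y, hφ y⟩
  have hxy : φ.1 (x * y) = φ.1 x + (x : G) • φ.1 y := cocycle_mul H φ x y
  have h1 : (⟨φ.1 (x * y), hφ (x * y)⟩ : S) = ⟨φ.1 x, hφ x⟩ + ⟨(x : G) • φ.1 y, hS x _ (hφ y)⟩ := Subtype.ext hxy
  rw [h1, map_add, hι x ⟨φ.1 y, hφ y⟩, Subgroup.smul_def]

include hι in
/-- ★ **Well-definedness on classes.** If `S`-valued coboundaries of `M` are coboundaries of elements of `S` (`hS0`), then `S`-valued cocycles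
`φ, φ'` with `[φ] = [φ']` in `H¹(H, M)` push to cocycles with `[ι∘φ] = [ι∘φ']` in `H¹(H, A)`. [cite: SerreGaloisCohomology1997, I §5.1] -/
theorem oneCocycleClass_comp_eq_of_eq
    (hS0 : ∀ m : M, (∀ x : H, (x : G) • m - m ∈ S) → ∃ s ∈ S, ∀ x : H, (x : G) • m - m = (x : G) • s - s)
    (φ φ' : contOneCocycles (discreteTopRep H M)) (hφ : ∀ x : H, φ.1 x ∈ S) (hφ' : ∀ x : H, φ'.1 x ∈ S)
    (ψ ψ' : contOneCocycles (discreteTopRep H A)) (hψ : ∀ x : H, ψ.1 x = ι ⟨φ.1 x, hφ x⟩)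
    (hψ' : ∀ x : H, ψ'.1 x = ι ⟨φ'.1 x, hφ' x⟩)
    (heq : oneCocycleClass (discreteTopRep H M) φ = oneCocycleClass (discreteTopRep H M) φ') :
    oneCocycleClass (discreteTopRep H A) ψ = oneCocycleClass (discreteTopRep H A) ψ' := by
  rw [← sub_eq_zero, ← oneCocycleClass_sub, oneCocycleClass_eq_zero_iff] at heq ⊢
  obtain ⟨m, hm⟩ := heq
  have hm' : ∀ x : H, φ.1 x - φ'.1 x = (x : G) • m - m := fun x ↦ by
    have h := hm x
    rw [sub_apply_val] at h
    exact h
  have hmS : ∀ x : H, (x : G) • m - m ∈ S := fun x ↦ by rw [← hm' x]; exact S.sub_mem (hφ x) (hφ' x)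
  obtain ⟨s, hsS, hs⟩ := hS0 m hmS
  refine ⟨ι ⟨s, hsS⟩, fun x ↦ ?_⟩
  rw [sub_apply_val, hψ, hψ', ← map_sub]
  change ι (⟨φ.1 x, hφ x⟩ - ⟨φ'.1 x, hφ' x⟩) = (x : G) • ι ⟨s, hsS⟩ - ι ⟨s, hsS⟩
  have h1 : (⟨φ.1 x, hφ x⟩ : S) - ⟨φ'.1 x, hφ' x⟩ = ⟨(x : G) • s, hS x s hsS⟩ - ⟨s, hsS⟩ :=
    Subtype.ext (by rw [AddSubgroupClass.coe_sub, AddSubgroupClass.coe_sub, hm' x, hs x])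
  rw [h1, map_sub, hι x ⟨s, hsS⟩]

omit [TopologicalSpace G] [IsTopologicalGroup G] [TopologicalSpace M] [DiscreteTopology M] in
/-- `hS0` for the torsion subgroup `S = M[r]`, first step: if `H⁰(H, M) = 0` then an element whose coboundary is killed by `r` is itself killed by
`r` (`r•(x•m − m) = x•(r•m) − r•m`), so `M[r]`-valued coboundaries are coboundaries of elements of `M[r]`. [cite: GreenbergVatsal2000, §2 p. 19] -/
theorem smul_eq_zero_of_forall_smul_sub_eq_zero {R : Type*} [Ring R] [Module R M] [SMulCommClass G R M]
    (hH0 : ∀ m : M, (∀ x : H, (x : G) • m = m) → m = 0) (r : R) (m : M)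
    (hm : ∀ x : H, r • ((x : G) • m - m) = 0) : r • m = 0 := by
  refine hH0 (r • m) fun x ↦ ?_
  have h := hm x
  rw [smul_sub, ← smul_comm (x : G) r m, sub_eq_zero] at h
  exact h

omit [TopologicalSpace G] [IsTopologicalGroup G] [TopologicalSpace M] [DiscreteTopology M] in
/-- The `hS0` hypothesis of `oneCocycleClass_comp_eq_of_eq` for `S = M[r] := {m | r • m = 0}` (any additive subgroup with this carrier) from
`H⁰(H, M) = 0`. [cite: GreenbergVatsal2000, §2 p. 19] -/
theorem smul_sub_mem_torsion_imp {R : Type*} [Ring R] [Module R M] [SMulCommClass G R M]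
    (hH0 : ∀ m : M, (∀ x : H, (x : G) • m = m) → m = 0) (r : R) (hSr : ∀ m : M, m ∈ S ↔ r • m = 0) (m : M)
    (hm : ∀ x : H, (x : G) • m - m ∈ S) : ∃ s ∈ S, ∀ x : H, (x : G) • m - m = (x : G) • s - s :=
  ⟨m, (hSr m).2 (smul_eq_zero_of_forall_smul_sub_eq_zero hH0 r m fun x ↦ (hSr _).1 (hm x)), fun _ ↦ rfl⟩

/-- ★ **Injectivity on classes.** If `ι(S) ⊆ A` has an `H`-equivariant additive retraction `ρ : A → M` (`ρ(ι s) = s`), then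
`[ι∘φ] = [ι∘φ']` in `H¹(H, A)` forces `[φ] = [φ']` in `H¹(H, M)` (`φ − φ' = ρ∘(ι∘φ − ι∘φ') = ρ(∂a) = ∂(ρ a)`). No `H⁰` hypothesis.
[cite: SerreGaloisCohomology1997, I §5.1] -/
theorem oneCocycleClass_eq_of_comp_eq (ρ : A →+ M) (hρ : ∀ (x : H) (a : A), ρ ((x : G) • a) = (x : G) • ρ a)
    (hρι : ∀ s : S, ρ (ι s) = s)
    (φ φ' : contOneCocycles (discreteTopRep H M)) (hφ : ∀ x : H, φ.1 x ∈ S) (hφ' : ∀ x : H, φ'.1 x ∈ S)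
    (ψ ψ' : contOneCocycles (discreteTopRep H A)) (hψ : ∀ x : H, ψ.1 x = ι ⟨φ.1 x, hφ x⟩)
    (hψ' : ∀ x : H, ψ'.1 x = ι ⟨φ'.1 x, hφ' x⟩)
    (heq : oneCocycleClass (discreteTopRep H A) ψ = oneCocycleClass (discreteTopRep H A) ψ') :
    oneCocycleClass (discreteTopRep H M) φ = oneCocycleClass (discreteTopRep H M) φ' := by
  rw [← sub_eq_zero, ← oneCocycleClass_sub, oneCocycleClass_eq_zero_iff] at heq ⊢
  obtain ⟨a, ha⟩ := heq
  refine ⟨ρ a, fun x ↦ ?_⟩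
  have h := ha x
  rw [sub_apply_val, hψ, hψ'] at h
  have hφx : φ.1 x = ρ (ι ⟨φ.1 x, hφ x⟩) := (hρι ⟨φ.1 x, hφ x⟩).symm
  have hφ'x : φ'.1 x = ρ (ι ⟨φ'.1 x, hφ' x⟩) := (hρι ⟨φ'.1 x, hφ' x⟩).symm
  rw [sub_apply_val, hφx, hφ'x, ← map_sub, h]
  change ρ ((x : G) • a - a) = (x : G) • ρ a - ρ a
  rw [map_sub, hρ]

include hι in
/-- ★★ **Packaged: an injective class map `T → H¹(H, A)`, `[φ] ↦ [ι ∘ φ]`, on any set `T` of classes represented by `S`-valued cocycles.**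
(D5-θ `torsion_subset_image_oneCocycleClass` makes `T = Sel[π]` eligible with `S = M[π]`; `hS0` from `H⁰ = 0` by `smul_sub_mem_torsion_imp`;
`ρ` = `ι⁻¹ ∘ e₁` from the eigen-decomposition.) Hence `#T = #(range Ψ)` and every local condition on `T` is read on the cocycles `ι ∘ φ`.
[cite: SerreGaloisCohomology1997, I §5.1] [cite: GreenbergVatsal2000, §2 p. 19] -/
theorem exists_injective_classMap
    (hS0 : ∀ m : M, (∀ x : H, (x : G) • m - m ∈ S) → ∃ s ∈ S, ∀ x : H, (x : G) • m - m = (x : G) • s - s)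
    (ρ : A →+ M) (hρ : ∀ (x : H) (a : A), ρ ((x : G) • a) = (x : G) • ρ a) (hρι : ∀ s : S, ρ (ι s) = s)
    (T : Set (subgroupH1 H M))
    (hT : ∀ c ∈ T, ∃ φ : contOneCocycles (discreteTopRep H M), oneCocycleClass _ φ = c ∧ ∀ x : H, φ.1 x ∈ S) :
    ∃ Ψ : T → subgroupH1 H A, Function.Injective Ψ ∧
      ∀ (c : T) (φ : contOneCocycles (discreteTopRep H M)) (hφ : ∀ x : H, φ.1 x ∈ S), oneCocycleClass _ φ = (c : subgroupH1 H M) →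
        ∀ ψ : contOneCocycles (discreteTopRep H A), (∀ x : H, ψ.1 x = ι ⟨φ.1 x, hφ x⟩) → Ψ c = oneCocycleClass _ ψ := by
  -- choose representatives and pushed cocycles
  choose φ hφc hφS using hT
  have hψex : ∀ (c : subgroupH1 H M) (hc : c ∈ T), ∃ ψ : contOneCocycles (discreteTopRep H A), ∀ x : H, ψ.1 x = ι ⟨(φ c hc).1 x, hφS c hc x⟩ :=
    fun c hc ↦ exists_cocycle_comp S hS ι hι (φ c hc) (hφS c hc)
  choose ψ hψ using hψex
  refine ⟨fun c ↦ oneCocycleClass _ (ψ c.1 c.2), fun c₁ c₂ h ↦ ?_, fun c φ₀ hφ₀ hc₀ ψ₀ hψ₀ ↦ ?_⟩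
  · apply Subtype.ext
    rw [← hφc c₁.1 c₁.2, ← hφc c₂.1 c₂.2]
    exact oneCocycleClass_eq_of_comp_eq S ι ρ hρ hρι _ _ (hφS _ c₁.2) (hφS _ c₂.2) _ _ (hψ _ c₁.2) (hψ _ c₂.2) h
  · exact oneCocycleClass_comp_eq_of_eq S hS ι hι hS0 _ _ (hφS _ c.2) hφ₀ _ _ (hψ _ c.2) hψ₀ ((hφc c.1 c.2).trans hc₀.symm)

end Entry

end Summit.BirchSwinnertonDyer.BirchSwinnertonDyer.Theorems.SmallImageCharSignedSelmer

end
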